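import Literature.NumberTheory.LFunctions.SuzukiScrewTestFunction
import Literature.NumberTheory.LFunctions.SoundArchTerm
import Literature.NumberTheory.LFunctions.WeilMellinBounds
import Literature.NumberTheory.LFunctions.WeilExplicitArchTermProofs
import HarnessLib

/-!
# Suzuki's test-function combination: the archimedean side (hypothesis `hA`)

LINE 1 — LABEL: RH-FREE support theorems (no fact is discharged or asserted here). Companion of
`SuzukiScrewTestFunction.lean` (dbl-t6 g4: `suzukiPhi`, `suzukiPhiC = c_tφ_{z,t} − c_{t′}φ_{z,t′}`,
`weilMellin_suzukiPhiC`) on the road to `Literature.NumberTheory.LFunctions.Suzuki2025_prop31`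
(M. Suzuki, Canad. J. Math. 2025 = arXiv:2301.00421v3, Prop 3.1, via Weil's explicit formula (3.3) in the
Bombieri form, tree `explicit_formula_continuous_bombieri`). This file supplies the ARCHIMEDEAN
INTEGRABILITY hypothesis `hA` of that explicit formula for `g = suzukiPhiC z t t′`:
`u ↦ ĝ(½ + iu)·Re ψ(¼ + iu/2)` is integrable (`integrable_weilMellin_suzukiPhiC_mul_reDigamma`), from the
closed form of `ĝ` (`weilMellin_suzukiPhiC` at `ρ = ½ + iu`, i.e. `γ = −u`: `|ĝ(½+iu)| ≤ 4(|c_t|+|c_{t′}|)/u²`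
for `|u| ≥ 2|z| + 1`), the strip bound `|ĝ| ≤ ∫|g|e^{|x|/2}` (`norm_weilMellin_le_weilL1`) and the digamma
growth `|Re ψ(¼ + iu/2)| ≤ C + log(1 + |u|)` (`SoundTest.exists_abs_reDigammaQuarter_le`).
v2 adds the EVALUATION OF THE BOMBIERI ARCHIMEDEAN TERM of `g` (`weilArchTermBombieri_suzukiPhiC`):
`W_∞^{Bombieri}(g) = −(c_t(A₅ + A₆(t)) − c_{t′}(A₅ + A₆(t′)))` with `A₅ = (2iz)⁻¹(ψ(¼ − iz/2) − ψ(¼))` and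
`A₆(s) = (2iz)⁻¹e^{−s/2}B(s,z)` the 5th/6th terms of (1.6) (`screwP`, `screwLerchBracket`) — the printed
computation of the "fifth term" (TeX l.866–975), organised as: Bombieri's expansion
`1/(2 sinh x) = Σ e^{−(2n+1)x}` (tree `hasSum_integral_bombieriTerms`, here for continuous Lipschitz `k`
with `k(0) = 0`), the Laplace transforms `∫₀^∞ φ_{z,s}(x)e^{−ax}dx = (1 − e^{−as})/(a(iz − a))`, partial
fractions, and the two series `Σ(1/(n+¼) − 1/(n+w)) = ψ(w) − ψ(¼)` ((EQ_304) = Andrews–Askey–Roy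
(1.2.13), tree `hasSum_one_div_sub_one_div_digamma`) and `Σ e^{−(2n+½)s}(…) = −e^{−s/2}B(s,z)`.
bears_on: B-C/B-P (COLUMN 6 DBR). WHAT THIS IS NOT: not the explicit formula and not Prop 3.1 (the
assembly with `tsum_zeroSide_eq_bombieri` and `Suzuki2025_prop31_of_sub_eq_const_mul` remains); nothing
here bears on the truth of RH.

## References

* M. Suzuki, *On the Hilbert space derived from the Weil distribution*, Canad. J. Math. (2025)
  = arXiv:2301.00421v3, proof of Prop. 3.1 (TeX l.794–980). [Suzuki2025WeilHilbertSpace]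
-/

noncomputable section

open Filter Topology Complex Set MeasureTheory

namespace Literature.NumberTheory.LFunctions

namespace SuzukiTestFunctionArch

/-- `γ(½ + iu) = −u`. [folklore] -/
private theorem zeroParam_half_add (u : ℝ) : suzukiZeroParam (1 / 2 + u * I) = -(u : ℂ) := by
  simp only [suzukiZeroParam]
  ring_nf
  rw [Complex.I_sq]
  ring

/-- `|e^{iut} − 1| ≤ 2` for real `u, t`. [folklore] -/
private theorem norm_cexp_sub_one_le (u t : ℝ) : ‖cexp (-(I * (-(u : ℂ)) * t)) - 1‖ ≤ 2 := by
  refine (norm_sub_le _ _).trans ?_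
  rw [Complex.norm_exp, norm_one]
  have : (-(I * (-(u : ℂ)) * t)).re = 0 := by simp
  rw [this, Real.exp_zero]
  norm_num

/-- **Tail decay of `ĝ` on the critical line**: `|ĝ(½ + iu)| ≤ 4(|c_t| + |c_{t′}|)/u²` for
`|u| ≥ 2|z| + 1` (from the closed form `weilMellin_suzukiPhiC` at `γ = −u`). [cite: Suzuki2025WeilHilbertSpace, proof of Prop. 3.1 (TeX l.822–826)] -/
theorem norm_weilMellin_suzukiPhiC_half_le {z : ℂ} (hz : 0 < z.im) {t t' : ℝ} (ht : 0 < t)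
    (ht' : 0 < t') {u : ℝ} (hu : 2 * ‖z‖ + 1 ≤ |u|) :
    ‖weilMellin (suzukiPhiC z t t') (1 / 2 + u * I)‖ ≤
      4 * (‖suzukiPhiCoeff z t‖ + ‖suzukiPhiCoeff z t'‖) / u ^ 2 := by
  have h1 := cexp_neg_I_mul_ne_one hz ht
  have h2 := cexp_neg_I_mul_ne_one hz ht'
  have hz0 : z ≠ 0 := by rintro rfl; simp at hz
  have hu0 : 0 < |u| := by linarith [norm_nonneg z]
  have hγ := zeroParam_half_add u
  have hγ0 : suzukiZeroParam (1 / 2 + u * I) ≠ 0 := by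
    rw [hγ, neg_ne_zero]; exact_mod_cast (abs_pos.1 hu0)
  have hγz : suzukiZeroParam (1 / 2 + u * I) ≠ z := by
    rw [hγ]; intro h; have := congrArg Complex.im h; simp at this; linarith
  rw [weilMellin_suzukiPhiC ht ht' hz0 h1 h2 hγ0 hγz, hγ]
  -- `|z + u| ≥ |u|/2`
  have hzu : |u| / 2 ≤ ‖z - -(u : ℂ)‖ := by
    rw [sub_neg_eq_add]
    have h := norm_sub_norm_le (u : ℂ) (-z)
    rw [Complex.norm_real, Real.norm_eq_abs, norm_neg, sub_neg_eq_add, add_comm] at h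
    linarith
  have hzu0 : 0 < ‖z - -(u : ℂ)‖ := by linarith
  have hnu : ‖(-(u : ℂ))‖ = |u| := by rw [norm_neg, Complex.norm_real, Real.norm_eq_abs]
  have hterm : ∀ s : ℝ, ‖(cexp (-(I * -(u : ℂ) * s)) - 1) / -(u : ℂ) * (1 / (z - -(u : ℂ)))‖ ≤
      2 / |u| * (2 / |u|) := by
    intro s
    rw [norm_mul, norm_div, norm_div, norm_one, hnu]
    have ha : ‖cexp (-(I * -(u : ℂ) * s)) - 1‖ / |u| ≤ 2 / |u| :=
      div_le_div_of_nonneg_right (norm_cexp_sub_one_le u s) hu0.le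
    have hb : 1 / ‖z - -(u : ℂ)‖ ≤ 2 / |u| := by
      rw [div_le_div_iff₀ hzu0 hu0]; linarith
    exact mul_le_mul ha hb (by positivity) (by positivity)
  calc ‖suzukiPhiCoeff z t * ((cexp (-(I * -(u : ℂ) * t)) - 1) / -(u : ℂ) * (1 / (z - -(u : ℂ)))) -
        suzukiPhiCoeff z t' * ((cexp (-(I * -(u : ℂ) * t')) - 1) / -(u : ℂ) * (1 / (z - -(u : ℂ))))‖
      ≤ ‖suzukiPhiCoeff z t‖ * (2 / |u| * (2 / |u|)) + ‖suzukiPhiCoeff z t'‖ * (2 / |u| * (2 / |u|)) := by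
        refine (norm_sub_le _ _).trans (add_le_add ?_ ?_)
        · rw [norm_mul]; exact mul_le_mul_of_nonneg_left (hterm t) (norm_nonneg _)
        · rw [norm_mul]; exact mul_le_mul_of_nonneg_left (hterm t') (norm_nonneg _)
    _ = 4 * (‖suzukiPhiCoeff z t‖ + ‖suzukiPhiCoeff z t'‖) / u ^ 2 := by
        rw [← sq_abs u]; field_simp; ring

/-- **Uniform decay `|ĝ(½ + iu)| ≤ K/(1 + u²)`** on the whole critical line (strip bound for small `u`,
tail decay for large `u`), for Suzuki's `φ_{z,t}`-combination. [cite: Suzuki2025WeilHilbertSpace, proof of Prop. 3.1 (TeX l.819–826)] -/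
theorem exists_norm_weilMellin_suzukiPhiC_half_le {z : ℂ} (hz : 0 < z.im) {t t' : ℝ} (ht : 0 < t)
    (ht' : 0 < t') :
    ∃ K : ℝ, 0 ≤ K ∧ ∀ u : ℝ, ‖weilMellin (suzukiPhiC z t t') (1 / 2 + u * I)‖ ≤ K / (1 + u ^ 2) := by
  have h1 := cexp_neg_I_mul_ne_one hz ht
  have h2 := cexp_neg_I_mul_ne_one hz ht'
  have hgc := continuous_suzukiPhiC z ht.le ht'.le
  have hgs := hasCompactSupport_suzukiPhiC z ht.le ht'.le h1 h2
  obtain ⟨B, hB⟩ : ∃ B : ℝ, B = weilL1 (suzukiPhiC z t t') := ⟨_, rfl⟩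
  have hB0 : 0 ≤ B := by rw [hB]; exact weilL1_nonneg _
  have hBle : ∀ u : ℝ, ‖weilMellin (suzukiPhiC z t t') (1 / 2 + u * I)‖ ≤ B := by
    intro u; rw [hB]; exact norm_weilMellin_le_weilL1 hgc hgs (by simp) (by simp; norm_num)
  obtain ⟨U, hU⟩ : ∃ U : ℝ, U = 2 * ‖z‖ + 1 := ⟨_, rfl⟩
  have hU0 : 1 ≤ U := by rw [hU]; linarith [norm_nonneg z]
  obtain ⟨D, hD⟩ : ∃ D : ℝ, D = ‖suzukiPhiCoeff z t‖ + ‖suzukiPhiCoeff z t'‖ := ⟨_, rfl⟩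
  have hD0 : 0 ≤ D := by rw [hD]; positivity
  refine ⟨max (B * (1 + U ^ 2)) (8 * D), le_max_of_le_left (by positivity), fun u ↦ ?_⟩
  by_cases hu : |u| ≤ U
  · have hu2 : u ^ 2 ≤ U ^ 2 := by rw [← sq_abs]; exact pow_le_pow_left₀ (abs_nonneg u) hu 2
    rw [le_div_iff₀ (by positivity)]
    calc ‖weilMellin (suzukiPhiC z t t') (1 / 2 + u * I)‖ * (1 + u ^ 2) ≤ B * (1 + U ^ 2) := by
          gcongr; exact hBle u
      _ ≤ max (B * (1 + U ^ 2)) (8 * D) := le_max_left _ _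
  · rw [not_le] at hu
    have h := norm_weilMellin_suzukiPhiC_half_le hz ht ht' (u := u) (by rw [← hU]; exact hu.le)
    rw [← hD] at h
    have hu1 : 1 ≤ u ^ 2 := by
      have : 1 ≤ |u| := by linarith
      rw [← sq_abs]; nlinarith
    refine h.trans ?_
    calc 4 * D / u ^ 2 ≤ 8 * D / (1 + u ^ 2) := by
          rw [div_le_div_iff₀ (by positivity) (by positivity)]; nlinarith [hD0, hu1]
      _ ≤ max (B * (1 + U ^ 2)) (8 * D) / (1 + u ^ 2) := by gcongr; exact le_max_right _ _

/-- **The archimedean integrability hypothesis `hA`** of `explicit_formula_continuous_bombieri` for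
`g = c_tφ_{z,t} − c_{t′}φ_{z,t′}` (`Im z > 0`, `t, t′ > 0`): `u ↦ ĝ(½ + iu)·Re ψ(¼ + iu/2)` is integrable.
[cite: Suzuki2025WeilHilbertSpace, proof of Prop. 3.1 (TeX l.819–826)] -/
theorem integrable_weilMellin_suzukiPhiC_mul_reDigamma {z : ℂ} (hz : 0 < z.im) {t t' : ℝ}
    (ht : 0 < t) (ht' : 0 < t') :
    Integrable fun u : ℝ ↦ weilMellin (suzukiPhiC z t t') (1 / 2 + u * I) *
      ((Complex.digamma (1 / 4 + u / 2 * I)).re : ℂ) := by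
  have h1 := cexp_neg_I_mul_ne_one hz ht
  have h2 := cexp_neg_I_mul_ne_one hz ht'
  have hgc := continuous_suzukiPhiC z ht.le ht'.le
  have hgs := hasCompactSupport_suzukiPhiC z ht.le ht'.le h1 h2
  obtain ⟨C, hC0, hC⟩ := SoundTest.exists_abs_reDigammaQuarter_le
  obtain ⟨K, hK0, hgb⟩ := exists_norm_weilMellin_suzukiPhiC_half_le hz ht ht'
  -- continuity
  have hcont : Continuous fun u : ℝ ↦ weilMellin (suzukiPhiC z t t') (1 / 2 + u * I) *
      ((Complex.digamma (1 / 4 + u / 2 * I)).re : ℂ) := by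
    refine ((continuous_weilMellin hgc hgs).comp (by fun_prop)).mul ?_
    exact Complex.continuous_ofReal.comp Literature.Analysis.SpecialFunctions.continuous_reDigammaQuarter
  -- domination by `4K(C + 2)(1 + |u|)^{-3/2}`
  have hdom : Integrable fun u : ℝ ↦ 4 * K * (C + 2) * (1 + ‖u‖) ^ (-(3 / 2 : ℝ)) :=
    ((integrable_one_add_norm (E := ℝ) (μ := volume) (r := 3 / 2) (by simp; norm_num)).const_mul _)
  refine Integrable.mono' hdom hcont.aestronglyMeasurable (Eventually.of_forall fun u ↦ ?_)
  rw [norm_mul, Complex.norm_real, Real.norm_eq_abs, Real.norm_eq_abs]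
  have hR := hC u
  have hg := hgb u
  set y : ℝ := 1 + |u| with hy
  have hy1 : 1 ≤ y := by rw [hy]; linarith [abs_nonneg u]
  have hlog : Real.log y ≤ 2 * Real.sqrt y := by
    have h1 : Real.log (Real.sqrt y) ≤ Real.sqrt y - 1 :=
      Real.log_le_sub_one_of_pos (Real.sqrt_pos.2 (by linarith))
    rw [Real.log_sqrt (by linarith)] at h1
    linarith
  have hsq : (1 + |u|) ^ 2 ≤ 2 * (1 + u ^ 2) := by
    nlinarith [sq_nonneg (|u| - 1), sq_abs u, abs_nonneg u]
  have hpow : y ^ (-(3 / 2 : ℝ)) = 1 / (y * Real.sqrt y) := by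
    rw [Real.rpow_neg (by linarith), one_div]
    congr 1
    rw [show (3 / 2 : ℝ) = 1 + 1 / 2 by norm_num, Real.rpow_add (by linarith), Real.rpow_one,
      Real.sqrt_eq_rpow]
  rw [hpow]
  have hyy : 0 < y * Real.sqrt y := by positivity
  have hlogy0 : 0 ≤ Real.log y := Real.log_nonneg hy1
  calc ‖weilMellin (suzukiPhiC z t t') (1 / 2 + u * I)‖ * |(Complex.digamma (1 / 4 + u / 2 * I)).re|
      ≤ K / (1 + u ^ 2) * (C + Real.log y) := by
        gcongr
        exact hR
    _ ≤ K / (y ^ 2 / 2) * (C + 2 * Real.sqrt y) := by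
        have hy2 : y ^ 2 / 2 ≤ 1 + u ^ 2 := by rw [hy]; linarith [hsq]
        gcongr
    _ = 2 * K * (C + 2 * Real.sqrt y) / y ^ 2 := by field_simp
    _ ≤ 4 * K * (C + 2) * (1 / (y * Real.sqrt y)) := by
        rw [div_le_iff₀ (by positivity), mul_one_div, div_mul_eq_mul_div, le_div_iff₀ hyy]
        have hs1 : 1 ≤ Real.sqrt y := by rw [Real.le_sqrt (by norm_num) (by linarith)]; linarith
        have hs2 : Real.sqrt y * Real.sqrt y = y := Real.mul_self_sqrt (by linarith)
        have hsy : Real.sqrt y ≤ y := by nlinarith [hs1, hs2]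
        have key : (C + 2 * Real.sqrt y) * Real.sqrt y ≤ 2 * (C + 2) * y := by
          have := mul_le_mul_of_nonneg_left hsy hC0
          nlinarith [this, hs2, hC0, hs1]
        have := mul_le_mul_of_nonneg_left key (by positivity : 0 ≤ 2 * K * y)
        nlinarith [this]

/-! ## The Laplace transforms `∫₀^∞ φ_{z,s}(x)e^{−ax}dx` -/

/-- `e^{(iz−a)s} = e^{−as}/e^{−izs}`. [folklore] -/
private theorem cexp_sub_mul (z : ℂ) (a : ℂ) (s : ℝ) :
    cexp ((I * z - a) * s) = cexp (-a * s) / cexp (-(I * z * s)) := by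
  rw [← Complex.exp_sub]; congr 1; ring

/-- **`∫₀^∞ φ_{z,s}(x)e^{−ax}dx = (1 − e^{−as})/(a(iz − a))`** for `a > 0`, `s > 0`, `Im z > 0`, together
with the integrability of the integrand on `(0, ∞)`. [cite: Suzuki2025WeilHilbertSpace, proof of Prop. 3.1 (TeX l.866–975)] -/
theorem integral_suzukiPhi_mul_cexp {z : ℂ} (hz : 0 < z.im) {s : ℝ} (hs : 0 < s) {a : ℝ} (ha : 0 < a) :
    IntegrableOn (fun x : ℝ ↦ suzukiPhi z s x * cexp (-(a : ℂ) * x)) (Ioi 0) ∧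
      ∫ x in Ioi (0 : ℝ), suzukiPhi z s x * cexp (-(a : ℂ) * x) =
        (1 - cexp (-(a : ℂ) * s)) / ((a : ℂ) * (I * z - a)) := by
  have hIz : I * z ≠ 0 := by
    apply mul_ne_zero I_ne_zero; rintro rfl; simp at hz
  have hre : (I * z - (a : ℂ)).re < 0 := by simp; linarith
  have hIza : I * z - (a : ℂ) ≠ 0 := by intro h; rw [h] at hre; simp at hre
  have ha0 : (a : ℂ) ≠ 0 := by exact_mod_cast ha.ne'
  have hna : -(a : ℂ) ≠ 0 := neg_ne_zero.2 ha0
  have hY : cexp (-(I * z * s)) ≠ 0 := Complex.exp_ne_zero _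
  have hcont : Continuous fun x : ℝ ↦ suzukiPhi z s x * cexp (-(a : ℂ) * x) :=
    (continuous_suzukiPhi z hs.le).mul (by fun_prop)
  -- the two pieces
  have hint1 : IntegrableOn (fun x : ℝ ↦ suzukiPhi z s x * cexp (-(a : ℂ) * x)) (Ioc 0 s) :=
    (hcont.integrableOn_Icc (a := 0) (b := s)).mono_set Ioc_subset_Icc_self
  have heq2 : EqOn (fun x : ℝ ↦ suzukiPhi z s x * cexp (-(a : ℂ) * x))
      (fun x : ℝ ↦ (I * z)⁻¹ * (cexp (-(I * z * s)) - 1) * cexp ((I * z - a) * x)) (Ioi s) := by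
    intro x hx
    simp only
    rw [suzukiPhi_of_lt z hs.le hx]
    have : cexp ((I * z - a) * x) = cexp (I * z * x) * cexp (-(a : ℂ) * x) := by
      rw [← Complex.exp_add]; congr 1; ring
    rw [this]; ring
  have hint2' : IntegrableOn (fun x : ℝ ↦ (I * z)⁻¹ * (cexp (-(I * z * s)) - 1) * cexp ((I * z - a) * x))
      (Ioi s) := (integrableOn_exp_mul_complex_Ioi hre s).const_mul _
  have hint2 : IntegrableOn (fun x : ℝ ↦ suzukiPhi z s x * cexp (-(a : ℂ) * x)) (Ioi s) :=
    hint2'.congr_fun heq2.symm measurableSet_Ioi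
  have hint : IntegrableOn (fun x : ℝ ↦ suzukiPhi z s x * cexp (-(a : ℂ) * x)) (Ioi 0) := by
    rw [← Ioc_union_Ioi_eq_Ioi hs.le]; exact hint1.union hint2
  refine ⟨hint, ?_⟩
  rw [← Ioc_union_Ioi_eq_Ioi hs.le, setIntegral_union Ioc_disjoint_Ioi_same measurableSet_Ioi hint1 hint2,
    setIntegral_congr_fun measurableSet_Ioi heq2, integral_const_mul, integral_exp_mul_complex_Ioi hre s,
    ← intervalIntegral.integral_of_le hs.le]
  -- the compact piece
  have h1 : ∫ x in (0 : ℝ)..s, suzukiPhi z s x * cexp (-(a : ℂ) * x) =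
      ∫ x in (0 : ℝ)..s, (I * z)⁻¹ * (cexp (-(a : ℂ) * x) - cexp ((I * z - a) * x)) := by
    refine intervalIntegral.integral_congr fun x hx ↦ ?_
    rw [uIcc_of_le hs.le, mem_Icc] at hx
    rw [suzukiPhi_of_mem' z hx.1 hx.2]
    have : cexp ((I * z - a) * x) = cexp (I * z * x) * cexp (-(a : ℂ) * x) := by
      rw [← Complex.exp_add]; congr 1; ring
    rw [this]; ring
  rw [h1, intervalIntegral.integral_const_mul, intervalIntegral.integral_sub
    ((by fun_prop : Continuous fun x : ℝ ↦ cexp (-(a : ℂ) * x)).intervalIntegrable _ _)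
    ((by fun_prop : Continuous fun x : ℝ ↦ cexp ((I * z - a) * x)).intervalIntegrable _ _),
    integral_exp_mul_complex hna, integral_exp_mul_complex hIza, cexp_sub_mul z a s]
  have hz0 : z ≠ 0 := by rintro rfl; simp at hz
  simp only [Complex.ofReal_zero, mul_zero, Complex.exp_zero]
  field_simp
  ring

/-- Partial fractions: with `a = 2n + ½` and `w = ¼ − iz/2`,
`1/(a(iz − a)) = (1/(2iz))·(1/(n + ¼) − 1/(n + w))`. [folklore] -/
private theorem partial_fraction {z : ℂ} (hz : 0 < z.im) (n : ℕ) :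
    1 / (((2 * n + 1 / 2 : ℝ) : ℂ) * (I * z - ((2 * n + 1 / 2 : ℝ) : ℂ))) =
      1 / (2 * I * z) * (1 / ((n : ℂ) + 1 / 4) - 1 / ((n : ℂ) + (1 / 4 - I * z / 2))) := by
  have hIz : I * z ≠ 0 := by
    apply mul_ne_zero I_ne_zero; rintro rfl; simp at hz
  have hn0 : (0 : ℝ) ≤ n := n.cast_nonneg
  have h1 : (n : ℂ) + 1 / 4 ≠ 0 := by
    intro h; have := congrArg Complex.re h; simp at this; linarith
  have h2 : (n : ℂ) + (1 / 4 - I * z / 2) ≠ 0 := by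
    intro h; have := congrArg Complex.re h; simp at this; linarith
  have h3 : I * z - ((2 * n + 1 / 2 : ℝ) : ℂ) ≠ 0 := by
    intro h; have := congrArg Complex.re h; simp at this; linarith
  have h4 : ((2 * n + 1 / 2 : ℝ) : ℂ) ≠ 0 := by
    have : (0 : ℝ) < 2 * n + 1 / 2 := by positivity
    exact_mod_cast this.ne'
  have hz0 : z ≠ 0 := by rintro rfl; simp at hz
  have key : ((2 * n + 1 / 2 : ℝ) : ℂ) * (I * z - ((2 * n + 1 / 2 : ℝ) : ℂ)) =
      -4 * (((n : ℂ) + 1 / 4) * ((n : ℂ) + (1 / 4 - I * z / 2))) := by push_cast; ring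
  rw [key, div_sub_div _ _ h1 h2]
  field_simp
  ring

/-! ## The two series -/

/-- `Σ_n (1/(n + ¼) − 1/(n + w)) = ψ(w) − ψ(¼)` for `Re w > 0` (CJM (EQ_304) = Andrews–Askey–Roy
(1.2.13), tree `hasSum_one_div_sub_one_div_digamma`). [cite: Suzuki2025WeilHilbertSpace, proof of Prop. 3.1, eq. (3.4)=(EQ_304) (TeX l.937–941)] -/
theorem hasSum_one_div_quarter_sub {w : ℂ} (hw : 0 < w.re) :
    HasSum (fun n : ℕ ↦ 1 / ((n : ℂ) + 1 / 4) - 1 / ((n : ℂ) + w))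
      (Complex.digamma w - Complex.digamma (1 / 4)) := by
  have h1 := Literature.Analysis.SpecialFunctions.Complex.hasSum_one_div_sub_one_div_digamma hw
  have h2 := Literature.Analysis.SpecialFunctions.Complex.hasSum_one_div_sub_one_div_digamma
    (w := (1 / 4 : ℂ)) (by norm_num)
  have h := h1.sub h2
  have e : (fun n : ℕ ↦ 1 / ((n : ℂ) + 1) - 1 / (w + n) - (1 / ((n : ℂ) + 1) - 1 / (1 / 4 + n))) =
      fun n : ℕ ↦ 1 / ((n : ℂ) + 1 / 4) - 1 / ((n : ℂ) + w) := by
    funext n; rw [add_comm w, add_comm (1 / 4 : ℂ)]; ring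
  rw [e, show Complex.digamma w + (Real.eulerMascheroniConstant : ℂ) -
      (Complex.digamma (1 / 4) + (Real.eulerMascheroniConstant : ℂ)) =
      Complex.digamma w - Complex.digamma (1 / 4) by ring] at h
  exact h

/-- The terms of the Hurwitz–Lerch bracket are summable (for `Im z ≥ 0`): `O(1/n²)`. [folklore] -/
private theorem summable_lerch_terms {z : ℂ} (hz : 0 ≤ z.im) (s : ℝ) :
    Summable fun n : ℕ ↦ (Real.exp (-(2 * |s| * n)) : ℂ) *
      (1 / ((n : ℂ) + (1 / 2 - I * z) / 2) - 1 / ((n : ℂ) + 1 / 4)) := by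
  obtain ⟨w, hw⟩ : ∃ w : ℂ, w = (1 / 2 - I * z) / 2 := ⟨_, rfl⟩
  have hwre : w.re = 1 / 4 + z.im / 2 := by rw [hw]; simp; ring
  have hgs : Summable fun n : ℕ ↦ 16 * ‖1 / 4 - w‖ / ((n : ℝ) + 1) ^ 2 := by
    have h1 : Summable (fun m : ℕ ↦ 1 / ((m + 1 : ℕ) : ℝ) ^ 2) :=
      (summable_nat_add_iff 1).mpr (Real.summable_one_div_nat_pow.mpr one_lt_two)
    refine (h1.mul_left (16 * ‖1 / 4 - w‖)).congr fun m ↦ ?_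
    push_cast; ring
  rw [← hw]
  refine Summable.of_norm_bounded hgs fun n ↦ ?_
  have hn0 : (0 : ℝ) ≤ n := n.cast_nonneg
  have hn4 : (n : ℂ) + 1 / 4 ≠ 0 := by
    intro h; have := congrArg Complex.re h; simp at this; linarith
  have hnw : (n : ℂ) + w ≠ 0 := by
    intro h; have := congrArg Complex.re h; simp [hwre] at this; linarith
  rw [norm_mul, Complex.norm_real, Real.norm_of_nonneg (Real.exp_pos _).le]
  have hexp : Real.exp (-(2 * |s| * n)) ≤ 1 := by
    rw [Real.exp_le_one_iff]; have := abs_nonneg s; nlinarith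
  have hpos : 0 < (n : ℝ) + 1 / 4 := by positivity
  have hdiff : ‖1 / ((n : ℂ) + w) - 1 / ((n : ℂ) + 1 / 4)‖ ≤ 16 * ‖1 / 4 - w‖ / ((n : ℝ) + 1) ^ 2 := by
    rw [div_sub_div _ _ hnw hn4, norm_div, norm_mul]
    have hA : ‖(n : ℂ) + 1 / 4‖ = n + 1 / 4 := by
      rw [show (n : ℂ) + 1 / 4 = ((n + 1 / 4 : ℝ) : ℂ) by push_cast; ring,
        Complex.norm_of_nonneg hpos.le]
    have hB : (n : ℝ) + 1 / 4 ≤ ‖(n : ℂ) + w‖ := by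
      have h := Complex.abs_re_le_norm ((n : ℂ) + w)
      have : ((n : ℂ) + w).re = n + w.re := by simp
      rw [this, hwre, abs_of_nonneg (by linarith)] at h
      linarith
    have hnum : ‖1 * ((n : ℂ) + 1 / 4) - ((n : ℂ) + w) * 1‖ = ‖1 / 4 - w‖ := by
      congr 1; ring
    rw [hnum, hA]
    rw [div_le_div_iff₀ (mul_pos (norm_pos_iff.2 hnw) hpos) (by positivity)]
    have h0 : 0 ≤ ‖1 / 4 - w‖ := norm_nonneg _
    have h1 : ((n : ℝ) + 1) ^ 2 ≤ 16 * (((n : ℝ) + 1 / 4) * ((n : ℝ) + 1 / 4)) := by nlinarith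
    have h2 : ((n : ℝ) + 1 / 4) * ((n : ℝ) + 1 / 4) ≤ ‖(n : ℂ) + w‖ * ((n : ℝ) + 1 / 4) :=
      mul_le_mul_of_nonneg_right hB hpos.le
    have h3 : ((n : ℝ) + 1) ^ 2 ≤ 16 * (‖(n : ℂ) + w‖ * ((n : ℝ) + 1 / 4)) :=
      h1.trans (by nlinarith [h2])
    calc ‖1 / 4 - w‖ * (((n : ℝ) + 1) ^ 2) ≤ ‖1 / 4 - w‖ * (16 * (‖(n : ℂ) + w‖ * ((n : ℝ) + 1 / 4))) :=
          mul_le_mul_of_nonneg_left h3 h0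
      _ = 16 * ‖1 / 4 - w‖ * (‖(n : ℂ) + w‖ * ((n : ℝ) + 1 / 4)) := by ring
  calc Real.exp (-(2 * |s| * n)) * ‖1 / ((n : ℂ) + w) - 1 / ((n : ℂ) + 1 / 4)‖
      ≤ 1 * (16 * ‖1 / 4 - w‖ / ((n : ℝ) + 1) ^ 2) := mul_le_mul hexp hdiff (norm_nonneg _) zero_le_one
    _ = 16 * ‖1 / 4 - w‖ / ((n : ℝ) + 1) ^ 2 := one_mul _

/-- The Lerch part: `Σ_n e^{−(2n+½)s}(1/(n+¼) − 1/(n+¼−iz/2)) = −e^{−s/2}·B(s,z)` (`s > 0`, `Im z ≥ 0`),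
`B = screwLerchBracket`. [cite: Suzuki2025WeilHilbertSpace, proof of Prop. 3.1 (TeX l.880–935)] -/
theorem hasSum_lerch_part {z : ℂ} (hz : 0 ≤ z.im) {s : ℝ} (hs : 0 < s) :
    HasSum (fun n : ℕ ↦ cexp (-((2 * n + 1 / 2 : ℝ) : ℂ) * s) *
        (1 / ((n : ℂ) + 1 / 4) - 1 / ((n : ℂ) + (1 / 4 - I * z / 2))))
      (-(((Real.exp (-(s / 2)) : ℝ) : ℂ) * screwLerchBracket s z)) := by
  have h := ((summable_lerch_terms hz s).hasSum).mul_left (-(((Real.exp (-(s / 2)) : ℝ) : ℂ)))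
  have hB : ∑' n : ℕ, (Real.exp (-(2 * |s| * n)) : ℂ) *
      (1 / ((n : ℂ) + (1 / 2 - I * z) / 2) - 1 / ((n : ℂ) + 1 / 4)) = screwLerchBracket s z := rfl
  rw [hB] at h
  have e : (fun n : ℕ ↦ -(((Real.exp (-(s / 2)) : ℝ) : ℂ)) * (((Real.exp (-(2 * |s| * n)) : ℝ) : ℂ) *
      (1 / ((n : ℂ) + (1 / 2 - I * z) / 2) - 1 / ((n : ℂ) + 1 / 4)))) =
      fun n : ℕ ↦ cexp (-((2 * n + 1 / 2 : ℝ) : ℂ) * s) *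
        (1 / ((n : ℂ) + 1 / 4) - 1 / ((n : ℂ) + (1 / 4 - I * z / 2))) := by
    funext n
    have h1 : (((Real.exp (-(s / 2)) : ℝ) : ℂ)) * ((Real.exp (-(2 * |s| * n)) : ℝ) : ℂ) =
        cexp (-((2 * n + 1 / 2 : ℝ) : ℂ) * s) := by
      rw [abs_of_pos hs, Complex.ofReal_exp, Complex.ofReal_exp, ← Complex.exp_add]
      congr 1; push_cast; ring
    rw [show (1 / 2 - I * z) / 2 = 1 / 4 - I * z / 2 by ring, ← h1]
    ring
  rw [e, neg_mul] at h
  exact h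

/-- **The per-`φ` archimedean series**: `Σ_n ∫₀^∞ φ_{z,s}(x)e^{−(2n+½)x}dx = A₅(z) + A₆(s,z)` with
`A₅ = (2iz)⁻¹(ψ(¼ − iz/2) − ψ(¼))`, `A₆(s) = (2iz)⁻¹e^{−s/2}B(s,z)` — the 5th and 6th terms of (1.6).
[cite: Suzuki2025WeilHilbertSpace, proof of Prop. 3.1 (TeX l.866–975)] -/
theorem hasSum_integral_suzukiPhi {z : ℂ} (hz : 0 < z.im) {s : ℝ} (hs : 0 < s) :
    HasSum (fun n : ℕ ↦ ∫ x in Ioi (0 : ℝ), suzukiPhi z s x * cexp ((-(2 * (n : ℂ)) - 1 / 2) * x))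
      (1 / (2 * I * z) * (Complex.digamma (1 / 4 - I * z / 2) - Complex.digamma (1 / 4)) +
        1 / (2 * I * z) * ((Real.exp (-(s / 2)) : ℝ) : ℂ) * screwLerchBracket s z) := by
  have hw : 0 < (1 / 4 - I * z / 2 : ℂ).re := by simp; linarith
  have hD := hasSum_one_div_quarter_sub hw
  have hL := hasSum_lerch_part hz.le hs
  have h := (hD.sub hL).mul_left (1 / (2 * I * z))
  have hterm : ∀ n : ℕ, ∫ x in Ioi (0 : ℝ), suzukiPhi z s x * cexp ((-(2 * (n : ℂ)) - 1 / 2) * x) =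
      1 / (2 * I * z) * ((1 / ((n : ℂ) + 1 / 4) - 1 / ((n : ℂ) + (1 / 4 - I * z / 2))) -
        cexp (-((2 * n + 1 / 2 : ℝ) : ℂ) * s) *
          (1 / ((n : ℂ) + 1 / 4) - 1 / ((n : ℂ) + (1 / 4 - I * z / 2)))) := by
    intro n
    have ha : (0 : ℝ) < 2 * n + 1 / 2 := by positivity
    have hI := (integral_suzukiPhi_mul_cexp hz hs ha).2
    have e : (fun x : ℝ ↦ suzukiPhi z s x * cexp ((-(2 * (n : ℂ)) - 1 / 2) * x)) =
        fun x : ℝ ↦ suzukiPhi z s x * cexp (-((2 * n + 1 / 2 : ℝ) : ℂ) * x) := by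
      funext x; congr 2; push_cast; ring
    rw [e, hI, ← one_div_mul_eq_div .., partial_fraction hz n]
    ring
  -- hmm: `(1 - E)/(a(iz-a)) = (1 - E) * (1/(a(iz-a)))`
  simp_rw [hterm]
  rw [show 1 / (2 * I * z) * (Complex.digamma (1 / 4 - I * z / 2) - Complex.digamma (1 / 4) -
      -(((Real.exp (-(s / 2)) : ℝ) : ℂ) * screwLerchBracket s z)) =
      1 / (2 * I * z) * (Complex.digamma (1 / 4 - I * z / 2) - Complex.digamma (1 / 4)) +
        1 / (2 * I * z) * ((Real.exp (-(s / 2)) : ℝ) : ℂ) * screwLerchBracket s z by ring] at h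
  exact h

/-! ## Bombieri's expansion `1/(2 sinh x) = Σ e^{−(2n+1)x}` for continuous Lipschitz-type `k` -/

/-- Bombieri's majorant `‖e^{x/2}k(x) − k(0)‖/(2 sinh x)` is integrable on `(0, ∞)` for a continuous
compactly supported `k` whose numerator is `O(x)` at `0` (the tree's `integrableOn_bombieriMajorant`,
with its `C^∞` hypothesis replaced by what its proof uses). [folklore] -/
private theorem integrableOn_bombieriMajorant' {k : ℝ → ℂ} (hkc : Continuous k) (hks : HasCompactSupport k)
    (hM : ∃ M : ℝ, 0 ≤ M ∧ ∀ x ∈ Icc (0 : ℝ) 1, ‖(Real.exp (x / 2) : ℂ) * k x - k 0‖ ≤ M * x) :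
    IntegrableOn (fun x : ℝ ↦ ‖(Real.exp (x / 2) : ℂ) * k x - k 0‖ / (2 * Real.sinh x))
      (Ioi 0) := by
  obtain ⟨M, hM0, hM⟩ := hM
  obtain ⟨K, hK⟩ := hkc.bounded_above_of_compact_support hks
  have hK0 : 0 ≤ K := (norm_nonneg _).trans (hK 0)
  set C : ℝ := M / 2 * Real.exp (1 / 2) + 4 * K with hC
  have hC0 : 0 ≤ C := by positivity
  refine Integrable.mono' ((exp_neg_integrableOn_Ioi 0 (by norm_num : (0 : ℝ) < 1 / 2)).const_mul C)
    ?_ ?_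
  · refine (Measurable.div ?_ ?_).aestronglyMeasurable
    · exact (by fun_prop : Continuous fun x : ℝ ↦ ‖(Real.exp (x / 2) : ℂ) * k x - k 0‖).measurable
    · exact (by fun_prop : Continuous fun x : ℝ ↦ 2 * Real.sinh x).measurable
  · refine (ae_restrict_iff' measurableSet_Ioi).2 (Eventually.of_forall fun x (hx : 0 < x) ↦ ?_)
    have hsinh : 0 < Real.sinh x := Real.sinh_pos_iff.2 hx
    have h2s : 0 < 2 * Real.sinh x := by positivity
    rw [Real.norm_eq_abs, abs_of_nonneg (div_nonneg (norm_nonneg _) h2s.le), div_le_iff₀ h2s]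
    rcases le_or_gt x 1 with hx1 | hx1
    · have e1 : 1 ≤ Real.exp (1 / 2) * Real.exp (-(1 / 2) * x) := by
        rw [← Real.exp_add]; exact Real.one_le_exp (by linarith)
      have e2 : x ≤ Real.sinh x := Real.self_le_sinh_iff.2 hx.le
      calc ‖(Real.exp (x / 2) : ℂ) * k x - k 0‖ ≤ M * x := hM x ⟨hx.le, hx1⟩
        _ ≤ M * Real.sinh x := by gcongr
        _ ≤ M * Real.sinh x * (Real.exp (1 / 2) * Real.exp (-(1 / 2) * x)) :=
            le_mul_of_one_le_right (by positivity) e1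
        _ = M / 2 * Real.exp (1 / 2) * Real.exp (-(1 / 2) * x) * (2 * Real.sinh x) := by ring
        _ ≤ C * Real.exp (-(1 / 2) * x) * (2 * Real.sinh x) := by
            gcongr
            rw [hC]
            linarith [mul_nonneg (by norm_num : (0 : ℝ) ≤ 4) hK0]
    · have hE1 : 1 ≤ Real.exp (x / 2) := Real.one_le_exp (by positivity)
      have hprod : Real.exp (-(1 / 2) * x) * Real.exp x = Real.exp (x / 2) := by
        rw [← Real.exp_add]; ring_nf
      have hex1 : Real.exp (-x) ≤ 1 := Real.exp_le_one_iff.2 (by linarith)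
      have hex2 : (2 : ℝ) ≤ Real.exp x := by linarith [Real.add_one_le_exp x]
      have h2s' : Real.exp x / 2 ≤ 2 * Real.sinh x := by rw [Real.sinh_eq]; linarith
      have hh : ‖(Real.exp (x / 2) : ℂ) * k x - k 0‖ ≤ Real.exp (x / 2) * K + K := by
        refine (norm_sub_le _ _).trans (add_le_add ?_ (hK 0))
        rw [norm_mul, Complex.norm_real, Real.norm_of_nonneg (Real.exp_pos _).le]
        exact mul_le_mul_of_nonneg_left (hK x) (Real.exp_pos _).le
      calc ‖(Real.exp (x / 2) : ℂ) * k x - k 0‖ ≤ Real.exp (x / 2) * K + K := hh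
        _ ≤ 2 * K * Real.exp (x / 2) := by nlinarith
        _ ≤ C / 2 * Real.exp (x / 2) := by
            gcongr
            rw [hC]
            nlinarith [Real.exp_pos (1 / 2)]
        _ = C * Real.exp (-(1 / 2) * x) * (Real.exp x / 2) := by rw [mul_assoc, ← hprod]; ring
        _ ≤ C * Real.exp (-(1 / 2) * x) * (2 * Real.sinh x) := by gcongr

/-- **Bombieri's expansion** `Σₙ ∫₀^∞ (k(x)e^{−(2n+½)x} − k(0)e^{−(2n+1)x})dx = ∫₀^∞ (e^{x/2}k(x) − k(0))dx/(2 sinh x)`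
for continuous compactly supported `k` with numerator `O(x)` at `0` (the tree's
`hasSum_integral_bombieriTerms` with its `C^∞` hypothesis replaced by what its proof uses).
[cite: Bombieri2000Weil, §2 eq. (2.8)] -/
theorem hasSum_integral_bombieriTerms' {k : ℝ → ℂ} (hkc : Continuous k) (hks : HasCompactSupport k)
    (hM : ∃ M : ℝ, 0 ≤ M ∧ ∀ x ∈ Icc (0 : ℝ) 1, ‖(Real.exp (x / 2) : ℂ) * k x - k 0‖ ≤ M * x) :
    HasSum (fun n : ℕ ↦ ∫ x in Ioi (0 : ℝ),
        (k x * cexp ((-(2 * (n : ℂ)) - 1 / 2) * x) - k 0 * cexp (-(2 * (n : ℂ) + 1) * x)))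
      (∫ x in Ioi (0 : ℝ), ((Real.exp (x / 2) : ℂ) * k x - k 0) / (2 * Real.sinh x : ℂ)) := by
  have hF : ∀ (n : ℕ) (x : ℝ),
      k x * cexp ((-(2 * (n : ℂ)) - 1 / 2) * x) - k 0 * cexp (-(2 * (n : ℂ) + 1) * x) =
        cexp (-(2 * (n : ℂ) + 1) * x) * ((Real.exp (x / 2) : ℂ) * k x - k 0) := by
    intro n x
    have e1 : ((Real.exp (x / 2) : ℝ) : ℂ) = cexp ((x : ℂ) / 2) := by
      rw [Complex.ofReal_exp]; push_cast; ring_nf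
    rw [e1, mul_sub, ← mul_assoc, ← Complex.exp_add]
    have e2 : -(2 * (n : ℂ) + 1) * x + (x : ℂ) / 2 = (-(2 * (n : ℂ)) - 1 / 2) * x := by ring
    rw [e2]
    ring
  have hpowC : ∀ (n : ℕ) (x : ℝ), cexp (-(2 * (n : ℂ) + 1) * x) =
      cexp (-(x : ℂ)) * cexp (-(2 * (x : ℂ))) ^ n := by
    intro n x
    rw [← Complex.exp_nat_mul, ← Complex.exp_add]
    congr 1
    ring
  have hpowR : ∀ (n : ℕ) (x : ℝ), Real.exp (-(2 * (n : ℝ) + 1) * x) =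
      Real.exp (-x) * Real.exp (-(2 * x)) ^ n := by
    intro n x
    rw [← Real.exp_nat_mul, ← Real.exp_add]
    congr 1
    ring
  have hnormF : ∀ (n : ℕ) (x : ℝ), ‖cexp (-(2 * (n : ℂ) + 1) * x)‖ = Real.exp (-(2 * (n : ℝ) + 1) * x) := by
    intro n x
    have hcast : (-(2 * (n : ℂ) + 1) * (x : ℂ)) = ((-(2 * (n : ℝ) + 1) * x : ℝ) : ℂ) := by
      push_cast; ring
    rw [hcast, Complex.norm_exp, Complex.ofReal_re]
  simp_rw [hF]
  refine hasSum_integral_of_dominated_convergence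
    (fun (n : ℕ) (x : ℝ) ↦ Real.exp (-(2 * (n : ℝ) + 1) * x) * ‖(Real.exp (x / 2) : ℂ) * k x - k 0‖)
    (fun n ↦ ?_) (fun n ↦ Eventually.of_forall fun x ↦ ?_) ?_ ?_ ?_
  · exact (by fun_prop : Continuous fun x : ℝ ↦ cexp (-(2 * (n : ℂ) + 1) * x) *
      ((Real.exp (x / 2) : ℂ) * k x - k 0)).aestronglyMeasurable
  · rw [norm_mul, hnormF]
  · refine (ae_restrict_iff' measurableSet_Ioi).2 (Eventually.of_forall fun x (hx : 0 < x) ↦ ?_)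
    have h0 : 0 ≤ Real.exp (-(2 * x)) := (Real.exp_pos _).le
    have h1 : Real.exp (-(2 * x)) < 1 := Real.exp_lt_one_iff.2 (by linarith)
    have e : (fun n : ℕ ↦ Real.exp (-(2 * (n : ℝ) + 1) * x) * ‖(Real.exp (x / 2) : ℂ) * k x - k 0‖) =
        fun n : ℕ ↦ Real.exp (-x) * ‖(Real.exp (x / 2) : ℂ) * k x - k 0‖ * Real.exp (-(2 * x)) ^ n := by
      funext n; rw [hpowR]; ring
    rw [e]
    exact (summable_geometric_of_lt_one h0 h1).mul_left _
  · refine ((integrableOn_bombieriMajorant' hkc hks hM).congr_fun (fun x (hx : 0 < x) ↦ ?_)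
      measurableSet_Ioi).integrable
    have h0 : 0 ≤ Real.exp (-(2 * x)) := (Real.exp_pos _).le
    have h1 : Real.exp (-(2 * x)) < 1 := Real.exp_lt_one_iff.2 (by linarith)
    have e : (fun n : ℕ ↦ Real.exp (-(2 * (n : ℝ) + 1) * x) * ‖(Real.exp (x / 2) : ℂ) * k x - k 0‖) =
        fun n : ℕ ↦ Real.exp (-x) * ‖(Real.exp (x / 2) : ℂ) * k x - k 0‖ * Real.exp (-(2 * x)) ^ n := by
      funext n; rw [hpowR]; ring
    show ‖(Real.exp (x / 2) : ℂ) * k x - k 0‖ / (2 * Real.sinh x) =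
      ∑' n : ℕ, Real.exp (-(2 * (n : ℝ) + 1) * x) * ‖(Real.exp (x / 2) : ℂ) * k x - k 0‖
    rw [e, tsum_mul_left, tsum_geometric_of_lt_one h0 h1, div_eq_mul_one_div,
      ← exp_neg_div_one_sub_exp hx]
    ring
  · refine (ae_restrict_iff' measurableSet_Ioi).2 (Eventually.of_forall fun x (hx : 0 < x) ↦ ?_)
    have hr : ‖cexp (-(2 * (x : ℂ)))‖ < 1 := by
      have hcast : (-(2 * (x : ℂ))) = ((-(2 * x) : ℝ) : ℂ) := by push_cast; ring
      rw [hcast, Complex.norm_exp, Complex.ofReal_re]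
      exact Real.exp_lt_one_iff.2 (by linarith)
    have hgeo := (hasSum_geometric_of_norm_lt_one hr).mul_left
      (cexp (-(x : ℂ)) * ((Real.exp (x / 2) : ℂ) * k x - k 0))
    have hC : cexp (-(x : ℂ)) / (1 - cexp (-(2 * (x : ℂ)))) = 1 / (2 * (Real.sinh x : ℂ)) := by
      have := congrArg (fun r : ℝ ↦ (r : ℂ)) (exp_neg_div_one_sub_exp hx)
      push_cast at this
      rw [Complex.ofReal_sinh]
      exact this
    have ef : (fun n : ℕ ↦ cexp (-(2 * (n : ℂ) + 1) * x) * ((Real.exp (x / 2) : ℂ) * k x - k 0)) =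
        fun n : ℕ ↦ cexp (-(x : ℂ)) * ((Real.exp (x / 2) : ℂ) * k x - k 0) *
          cexp (-(2 * (x : ℂ))) ^ n := by
      funext n
      rw [hpowC]
      ring
    have ev : ((Real.exp (x / 2) : ℂ) * k x - k 0) / (2 * (Real.sinh x : ℂ)) =
        cexp (-(x : ℂ)) * ((Real.exp (x / 2) : ℂ) * k x - k 0) * (1 - cexp (-(2 * (x : ℂ))))⁻¹ := by
      calc ((Real.exp (x / 2) : ℂ) * k x - k 0) / (2 * (Real.sinh x : ℂ))
          = ((Real.exp (x / 2) : ℂ) * k x - k 0) * (1 / (2 * (Real.sinh x : ℂ))) := by ring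
        _ = ((Real.exp (x / 2) : ℂ) * k x - k 0) *
            (cexp (-(x : ℂ)) / (1 - cexp (-(2 * (x : ℂ))))) := by rw [hC]
        _ = _ := by ring
    rw [ef, ev]
    exact hgeo

/-- For the combination `g` (`g(0) = 0`, Lipschitz): `‖e^{x/2}g(x) − g(0)‖ ≤ e^{1/2}L·x` on `[0, 1]`. [folklore] -/
private theorem exists_numerator_le {z : ℂ} (hz : 0 < z.im) {t t' : ℝ} (ht : 0 < t) (ht' : 0 < t') :
    ∃ M : ℝ, 0 ≤ M ∧ ∀ x ∈ Icc (0 : ℝ) 1,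
      ‖(Real.exp (x / 2) : ℂ) * suzukiPhiC z t t' x - suzukiPhiC z t t' 0‖ ≤ M * x := by
  obtain ⟨L, hL⟩ := lipschitzWith_suzukiPhiC z ht ht' (cexp_neg_I_mul_ne_one hz ht)
    (cexp_neg_I_mul_ne_one hz ht')
  refine ⟨Real.exp (1 / 2) * L, by positivity, fun x hx ↦ ?_⟩
  have h := hL.dist_le_mul x 0
  rw [dist_eq_norm, Real.dist_eq, sub_zero, abs_of_nonneg hx.1, suzukiPhiC_zero, sub_zero] at h
  rw [suzukiPhiC_zero, sub_zero, norm_mul, Complex.norm_real, Real.norm_of_nonneg (Real.exp_pos _).le]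
  have he : Real.exp (x / 2) ≤ Real.exp (1 / 2) := Real.exp_le_exp.2 (by linarith [hx.2])
  calc Real.exp (x / 2) * ‖suzukiPhiC z t t' x‖ ≤ Real.exp (1 / 2) * (L * x) :=
        mul_le_mul he h (norm_nonneg _) (Real.exp_pos _).le
    _ = Real.exp (1 / 2) * L * x := by ring

/-! ## The archimedean term of `g = c_tφ_{z,t} − c_{t′}φ_{z,t′}` -/

/-- **The Bombieri archimedean term of `g_{z;t,t′}`** (`Im z > 0`, `t, t′ > 0`):
`weilArchTermBombieri g = −(c_t(A₅ + A₆(t)) − c_{t′}(A₅ + A₆(t′)))`, `A₅ = (2iz)⁻¹(ψ(¼ − iz/2) − ψ(¼))`,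
`A₆(s) = (2iz)⁻¹e^{−s/2}B(s,z)` — the 5th and 6th terms of `screwP` (CJM (1.6)), with the sign with which
they enter `𝔓_t`. This is the printed computation of the "fifth term" of (3.3) for `φ_{z,t}`
(TeX l.866–975), done for the compactly supported combination. [cite: Suzuki2025WeilHilbertSpace, proof of Prop. 3.1 (TeX l.866–975)] -/
theorem weilArchTermBombieri_suzukiPhiC {z : ℂ} (hz : 0 < z.im) {t t' : ℝ} (ht : 0 < t) (ht' : 0 < t') :
    weilArchTermBombieri (suzukiPhiC z t t') =
      -(suzukiPhiCoeff z t *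
          (1 / (2 * I * z) * (Complex.digamma (1 / 4 - I * z / 2) - Complex.digamma (1 / 4)) +
            1 / (2 * I * z) * ((Real.exp (-(t / 2)) : ℝ) : ℂ) * screwLerchBracket t z) -
        suzukiPhiCoeff z t' *
          (1 / (2 * I * z) * (Complex.digamma (1 / 4 - I * z / 2) - Complex.digamma (1 / 4)) +
            1 / (2 * I * z) * ((Real.exp (-(t' / 2)) : ℝ) : ℂ) * screwLerchBracket t' z)) := by
  have h1 := cexp_neg_I_mul_ne_one hz ht
  have h2 := cexp_neg_I_mul_ne_one hz ht'
  have hgc := continuous_suzukiPhiC z ht.le ht'.le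
  have hgs := hasCompactSupport_suzukiPhiC z ht.le ht'.le h1 h2
  -- Bombieri's expansion for `g`
  have hS1 := hasSum_integral_bombieriTerms' hgc hgs (exists_numerator_le hz ht ht')
  simp_rw [suzukiPhiC_zero, zero_mul, sub_zero] at hS1
  -- the same series computed termwise
  have hterm : ∀ n : ℕ, ∫ x in Ioi (0 : ℝ), suzukiPhiC z t t' x * cexp ((-(2 * (n : ℂ)) - 1 / 2) * x) =
      suzukiPhiCoeff z t * (∫ x in Ioi (0 : ℝ), suzukiPhi z t x * cexp ((-(2 * (n : ℂ)) - 1 / 2) * x)) -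
        suzukiPhiCoeff z t' *
          (∫ x in Ioi (0 : ℝ), suzukiPhi z t' x * cexp ((-(2 * (n : ℂ)) - 1 / 2) * x)) := by
    intro n
    have ha : (0 : ℝ) < 2 * n + 1 / 2 := by positivity
    have e : ∀ x : ℝ, cexp ((-(2 * (n : ℂ)) - 1 / 2) * x) = cexp (-((2 * n + 1 / 2 : ℝ) : ℂ) * x) := by
      intro x; congr 1; push_cast; ring
    simp_rw [e]
    have hi1 := ((integral_suzukiPhi_mul_cexp hz ht ha).1).const_mul (suzukiPhiCoeff z t)
    have hi2 := ((integral_suzukiPhi_mul_cexp hz ht' ha).1).const_mul (suzukiPhiCoeff z t')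
    have hcongr : ∫ x in Ioi (0 : ℝ), suzukiPhiC z t t' x * cexp (-((2 * n + 1 / 2 : ℝ) : ℂ) * x) =
        ∫ x in Ioi (0 : ℝ), (suzukiPhiCoeff z t * (suzukiPhi z t x * cexp (-((2 * n + 1 / 2 : ℝ) : ℂ) * x)) -
          suzukiPhiCoeff z t' * (suzukiPhi z t' x * cexp (-((2 * n + 1 / 2 : ℝ) : ℂ) * x))) :=
      setIntegral_congr_fun measurableSet_Ioi fun x _ ↦ by simp only [suzukiPhiC]; ring
    rw [hcongr, integral_sub hi1 hi2, integral_const_mul, integral_const_mul]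
  have hS2 : HasSum (fun n : ℕ ↦ ∫ x in Ioi (0 : ℝ),
      suzukiPhiC z t t' x * cexp ((-(2 * (n : ℂ)) - 1 / 2) * x))
      (suzukiPhiCoeff z t *
          (1 / (2 * I * z) * (Complex.digamma (1 / 4 - I * z / 2) - Complex.digamma (1 / 4)) +
            1 / (2 * I * z) * ((Real.exp (-(t / 2)) : ℝ) : ℂ) * screwLerchBracket t z) -
        suzukiPhiCoeff z t' *
          (1 / (2 * I * z) * (Complex.digamma (1 / 4 - I * z / 2) - Complex.digamma (1 / 4)) +
            1 / (2 * I * z) * ((Real.exp (-(t' / 2)) : ℝ) : ℂ) * screwLerchBracket t' z)) := by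
    simp_rw [hterm]
    have h3 := ((hasSum_integral_suzukiPhi hz ht).mul_left (suzukiPhiCoeff z t)).sub
      ((hasSum_integral_suzukiPhi hz ht').mul_left (suzukiPhiCoeff z t'))
    exact h3
  have hI := hS1.unique hS2
  -- the Bombieri integrand of `g`: `g(0) = 0`, `g(−x) = 0` for `x > 0`
  have hint : ∫ x in Ioi (0 : ℝ), ((Real.exp (x / 2) : ℂ) * (suzukiPhiC z t t' x + suzukiPhiC z t t' (-x)) -
      2 * suzukiPhiC z t t' 0) / (2 * Real.sinh x : ℂ) =
      ∫ x in Ioi (0 : ℝ), ((Real.exp (x / 2) : ℂ) * suzukiPhiC z t t' x) / (2 * Real.sinh x : ℂ) := by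
    refine setIntegral_congr_fun measurableSet_Ioi fun x (hx : 0 < x) ↦ ?_
    rw [suzukiPhiC_of_nonpos z t t' (by linarith : -x ≤ 0), suzukiPhiC_zero]
    ring
  rw [weilArchTermBombieri_eq, hint, hI, suzukiPhiC_zero]
  ring

end SuzukiTestFunctionArch

end Literature.NumberTheory.LFunctions

end
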